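import Summits.QuantumFields.BalabanUV.Beta.D1BFx.GhostSqrtLegFib
import Summits.QuantumFields.BalabanUV.Beta.D1BFx.TorusBondArrays
import Summits.QuantumFields.BalabanUV.Beta.D1BFx.TorusGhostPairArrays
import Summits.QuantumFields.BalabanUV.Beta.D1BFx.TorusTraceBubbleTwoLeg

/-!
# `BalabanUV.Beta.D1BFx.GhostSqrtLegLimit` — road «BF-x» for binder row D1, slot (K), chain step (S-GH), «GH-DICT» PART 2b, FILE 2∕2:
# THE `ℤ⁴` READING OF (S-GH) ALONG `p → ∞` — generic jets, family form, and THE JETS OF RECORD: `hessKer (Cgh n a) Lgh Lgh₂ μ ν z` IN CLOSED FORM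

HONEST DEPENDENCY (page 1, mandatory): continuum YM on T⁴ ⇐ BetaPertH ∧ nine spine estimates (0/9 proved); BetaPertH ⇐ (D1) ∧ (D4) ∧
CAP+tail; G-an2-4 gates asym, D1 and NE2/3/4.  HONEST FRAMING (cell contract, verbatim): «discharging `BetaPertH` makes Bałaban's UV
stability UNCONDITIONAL — a real constructive-QFT result; it is NOT the continuum limit and NOT the Clay problem.»  THIS MODULE DISCHARGES
NOTHING of the wall: [folklore] absolutely convergent lattice bookkeeping — every `p → ∞` limit is a socket USED BY NAME (TA3b
`TorusTraceTadpole.tendsto_trace_tadpole`∕`tendsto_trace_bubble` (gan24-leaf-03 g43), TA3b-BUBBLE₂ `TorusTraceBubbleTwoLeg.tendsto_trace_bubble₂'`∕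
`tendsto_trace_arr_arr` (owner d1-p2 g15, (K5)), `KGhostLeg.tendsto_hessT_Cgh` (owner g7)), the per-torus identity is FILE 1
(`GhostSqrtLegFib.hessT_Cgh_biLaplacian_split`, `hat_legs`), the array letters are leaf-03's (`TorusGhostWordArrays.Lsq_word_eq_perT`,
`TorusGhostPairArrays.Lsq_pair_word_eq_perT`, `Ljet_eq_perT`, `Ljet₁₁_eq_perT`, `TorusBondArrays.hat_arr_smul`), the decay∕locality letters are the
typer's∕leaf-05's∕an2's (`decays_Ggh`, `shiftK_Ggh`, `decays_Pgt`, `shiftK_Pgt`, `biLoc_ghCur`, `biLoc_gh₂`, `biLoc_Lgh`, `biLoc_Lgh₂`, `biLoc_smul'`,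
`decays_comp`), uniqueness of limits is Mathlib's `tendsto_nhds_unique`.  No definition, no `def … : Prop`, nothing cited, 0 sorry.  0 root-level
binders discharged (hW ∕ hR-sockets ∕ hSX-socket ∕ D1Tel ∕ D1Rep = 0); the sixteen remainder words are DISPLAYED, not estimated; NOT (K), NOT D1,
NOT `BetaPertH`, NOT continuum, NOT Clay.

ABSOLUTE RULE (cell charter, verbatim): «No internally-minted statement may enter as a cited fact. Every hypothesis is either kernel-proved in
this package or a verbatim quotation of a PUBLISHED theorem with page reference. The manuscript(s) under audit are NOT citable for their own
disputed steps — they are the thing under adjudication; programme-internal (2001/route/tribunal) claims are never citable.»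

WHY (owner d1-p2, `DICT-CHAIN-SPEC.md` v1.2 §1 (S-GH) ∕ §7 «GH-DICT»; rulings ρ-g14-2, **ρ-g15-1** «PART 2b = the `ℤ⁴` reading of
`GhostSqrtLeg.hessT_Chat_biLaplacian_split` word by word via TA3b sockets with COMPOSITE LEGS — no coarse-Gram rewrite; output ONE `Tendsto` theorem
with limit `2·hessKer (Ggh n a) (n²•𝒱) (n²•𝒲) μ ν z − Σ (sixteen ℤ⁴ words)`»; first refusal leaf-04 lineage).  (S-GH) asks for the identity between the
ghost slot of (A1) — `hessKer (Cgh n a) Lgh Lgh₂ μ ν z` in `KCombineCovStripped.hessKer_transfer_road_cov_stripped` ∕ `KCombineCovTowers.tendsto_gramCov_tower`,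
the `p → ∞` limit of the torus bi-Laplacian ghost functional of route T — and a ONE-LEG functional of the tower leg `Ggh` with named remainder
kernels.  THIS FILE:
* §1 [folklore] **`tendsto_hessT_Cgh_biLaplacian`** (GENERIC JETS): for scalar `ℤ⁴` jets `V V′ W` bi-localised at a common rate, periodised as ARRAYS on
  `Site 4 (n·p_k)`, `p_k → ∞`: `hessT ((Cgh)^; V̂L̂ + L̂V̂, V̂′L̂ + L̂V̂′, ŴL̂ + V̂V̂′ + V̂′V̂ + L̂Ŵ)` CONVERGES to
  `2·(½·tadpole (Ggh n a) (n²•W) − ½·bubble (Ggh n a) (n²•V) (n²•V′)) − PRem`, `PRem` = the sixteen explicit `ℤ⁴` trace words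
  (`tr (comp (comp A X) (comp B Y))`, `tr (comp (comp L X) Y)`, `tr (comp L Y)`) over the legs `Pgt∘Ggh`, `Ggh∘Pgt`, `Ggh∘Ggh`, `Ggh∘(Pgt∘Ggh)`, `Pgt`,
  `Ggh` and the rescaled jets, in the sixteen-slot layout of `GhostSqrtLeg.eightWords_split` (per torus FILE 1 §2; word by word the sockets above).
* §2 [folklore] **`tendsto_hessT_Cgh_biLaplacian_family`**: the same at base-point families — limit `2·hessKer (Ggh n a) (n²•𝒱) (n²•𝒲) μ ν z − PRem`
  (ρ-g15-1 display; `hessKer` by `rfl`).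
* §3 [folklore] THE JETS OF RECORD: `submatrix_fst_submatrix_unit`, `hat_arr_Lgh`, `hat_arr_Lgh₂` (the arrays of the `L̂²`-word families `Lgh`∕`Lgh₂` ARE the bi-Laplacian words of the
  arrays of the ghost currents `ghCur` and of the mixed table `[u = u′ ∧ κ = l]•gh₂ κ u`, the latter for `|u − u′|₁ + 3 ≤ s`), and
  **`hessKer_Cgh_Lgh_eq`**: `hessKer (Cgh n a) Lgh Lgh₂ μ ν z = 2·hessKer (Ggh n a) (n²•ghCur) (n²•gh₁₁) μ ν z − PRem(record jets)` for every `μ ν z`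
  (both members are limits of the same torus sequence eventually — `KGhostLeg.tendsto_hessT_Cgh` and §2 — and `tendsto_nhds_unique`).
READING FOR THE ROAD: the ghost slot (A1) of record carries is, on `ℤ⁴`, loop weight `2` × ONE leg `Ggh` × the `n²`-rescaled FINE-bond ghost currents,
minus sixteen NAMED rest words (the RK-GH kernels of DICT-CHAIN-SPEC §2); PART 3 (comparison with `PghQ n a x₀ cK cQ` on the ray: block reduction
`vertexRedF`∕`tableRedF` of these fine jets, second table `gh₂` vs `ghCnt`∕`WghAt`; ρ-g14-2 «pins follow the output») is NOT in this file.
Unit `b2b-balaban-beta-d1-formalise-leaf-04` (gen 17), D1 formalisation swarm; journal INTENT [D1LEAF04-G17-INTENT-1].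
-/

noncomputable section


namespace Summit.QuantumFields.BalabanUV.Beta.D1BFx.GhostSqrtLegLimit

open Matrix Filter Topology
open scoped BigOperators
open Literature.MathematicalPhysics.QuantumFieldTheory.Balaban1983to89
open Literature.MathematicalPhysics.QuantumFieldTheory.Balaban1983to89.Beta
open B12Sec2to5 (l1)
open ExpKernelCalculus (MKer Decays BiLoc comp tr bubble tadpole hessKer shiftK comp_shiftK)
open AffineAveraging (unitVec)
open Summit.QuantumFields.BalabanUV.Beta.TameKernelCalculus (decays_of_le biLoc_of_le)
open Summit.QuantumFields.BalabanUV.Beta.D1BFx.FibredPeriodisation (Kfib periodiseF periodiseF_apply)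
open Summit.QuantumFields.BalabanUV.Beta.D1BFx.PeriodicArrays (arr toF toF_apply Kfib_toF periodic_of_shiftK)
open Summit.QuantumFields.BalabanUV.Beta.D1BFx.MixedVarPackedHess (hessT)
open Summit.QuantumFields.BalabanUV.Beta.D1BFx.RProjector (Pgt Pgt_apply deltaPP deltaPP_pos)
open Summit.QuantumFields.BalabanUV.Beta.D1BFx.RJetProjector (decays_Pgt shiftK_Pgt)
open Summit.QuantumFields.BalabanUV.Beta.D1BFx.GhostLeg (Ggh decays_Ggh shiftK_Ggh)
open Summit.QuantumFields.BalabanUV.Beta.D1BFx.GhostStencil (ghCur biLoc_ghCur)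
open Summit.QuantumFields.BalabanUV.Beta.D1BFx.TorusGhostLegs (tendsto_mul_period)
open Summit.QuantumFields.BalabanUV.Beta.D1BFx.KGhostLeg (Cgh tendsto_hessT_Cgh)
open Summit.QuantumFields.BalabanUV.Beta.D1BFx.TorusGhostWordArrays (perT lapU Lgh biLoc_Lgh Lhat_eq_perT Ljet_eq_perT Lsq_word_eq_perT
  submatrix_unit_mul)
open Summit.QuantumFields.BalabanUV.Beta.D1BFx.TorusGhostPairStencils (gh₂ Lgh₂ biLoc_gh₂ biLoc_Lgh₂ perT_zero arr_zero biLoc_zero_of_nonneg)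
open Summit.QuantumFields.BalabanUV.Beta.D1BFx.TorusGhostPairArrays (Ljet₁₁_eq_perT Lsq_pair_word_eq_perT)
open Summit.QuantumFields.BalabanUV.Beta.D1BFx.TorusCoframeJets (Ljet Ljet₁₁)
open Summit.QuantumFields.BalabanUV.Beta.D1BFx.TorusBondArrays (hat_arr_smul)
open Summit.QuantumFields.BalabanUV.Beta.D1BFx.GhostKernel (biLoc_smul')
open Summit.QuantumFields.BalabanUV.Beta.D1BFx.TorusTraceTadpole (tendsto_trace_tadpole tendsto_trace_bubble)
open Summit.QuantumFields.BalabanUV.Beta.D1BFx.TorusTraceBubbleTwoLeg (tendsto_trace_bubble₂' tendsto_trace_arr_arr)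
open Summit.QuantumFields.BalabanUV.Beta.D1BFx.GhostSqrtLegFib (hessT_Cgh_biLaplacian_split hat_legs imageShift_mul_of_shiftK shiftK_comp_of_shiftK)
open Literature.MathematicalPhysics.QuantumFieldTheory.Balaban1983to89.Beta.BalabanStepJetsSucc (decays_comp)
open B6QGQDecay237 (deltaU deltaU_pos)

/-! ## §1 GH-DICT PART 2b — THE `ℤ⁴` READING, GENERIC JETS: every word along the fine tori `Site 4 (n·p_k)`, `p_k → ∞` -/

section Limit

variable (n : ℕ) [NeZero n] (a : ℝ) {V V' W : MKer 4 Unit} {P P' Q Q' : Fin 4 → ℤ} {C Cv Cv' δ : ℝ} {p : ℕ → ℕ} [∀ k, NeZero (p k)]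

/-- [folklore] **GH-DICT PART 2b — THE `ℤ⁴` READING OF (S-GH), GENERIC JETS.**  For `0 < a`, block side `n ≥ 1`, scalar `ℤ⁴` jets `V` (bi-localised at
`(P, P′)`), `V′` (at `(Q′, Q)`), `W` (at `(P, Q)`) with a common rate `δ > 0`, periodised as ARRAYS on the fine tori `Site 4 (n·p_k)` with `p_k → ∞`: the
bi-Laplacian ghost functional of the periodised composite leg `(Cgh n a)^` over the words of `L̂ = (lapU)^`,
`hessT (Cgh)^ (V̂L̂ + L̂V̂) (V̂′L̂ + L̂V̂′) (ŴL̂ + V̂V̂′ + V̂′V̂ + L̂Ŵ)`, CONVERGES to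
`2·(½·tadpole (Ggh n a) (n²•W) − ½·bubble (Ggh n a) (n²•V) (n²•V′))` — loop weight `2`, ONE leg `Ggh`, jets rescaled by `n²` — MINUS the sixteen `ℤ⁴`
trace words of the `P`-REMAINDER (legs `Pgt∘Ggh`, `Ggh∘Pgt`, `Ggh∘Ggh`, `Ggh∘(Pgt∘Ggh)`, `Pgt`, `Ggh` against the rescaled jets; same sixteen-slot layout as
`GhostSqrtLeg.eightWords_split`).  Per torus this is §2; the limit of every word is a socket BY NAME: TA3b `tendsto_trace_tadpole`∕`tendsto_trace_bubble`
(`TorusTraceTadpole`), TA3b-BUBBLE₂ `tendsto_trace_bubble₂'`∕`tendsto_trace_arr_arr` (`TorusTraceBubbleTwoLeg`, owner d1-p2 g15), the product letters `hat_legs`,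
`TorusBondArrays.hat_arr_smul`.  Nothing is asserted about `PghQ` (PART 3). -/
theorem tendsto_hessT_Cgh_biLaplacian (ha : 0 < a) (hV : BiLoc V P P' Cv δ) (hV' : BiLoc V' Q' Q Cv' δ) (hW : BiLoc W P Q C δ)
    (hδ : 0 < δ) (hp : Tendsto p atTop atTop) :
    Tendsto (fun k => hessT (Matrix.of (periodiseF (n * p k) (toF (Cgh n a))))
        (Matrix.of (periodiseF (n * p k) (toF (arr (n * p k) V))) * Matrix.of (periodiseF (n * p k) (toF lapU))
          + Matrix.of (periodiseF (n * p k) (toF lapU)) * Matrix.of (periodiseF (n * p k) (toF (arr (n * p k) V))))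
        (Matrix.of (periodiseF (n * p k) (toF (arr (n * p k) V'))) * Matrix.of (periodiseF (n * p k) (toF lapU))
          + Matrix.of (periodiseF (n * p k) (toF lapU)) * Matrix.of (periodiseF (n * p k) (toF (arr (n * p k) V'))))
        (Matrix.of (periodiseF (n * p k) (toF (arr (n * p k) W))) * Matrix.of (periodiseF (n * p k) (toF lapU))
          + Matrix.of (periodiseF (n * p k) (toF (arr (n * p k) V))) * Matrix.of (periodiseF (n * p k) (toF (arr (n * p k) V')))
          + Matrix.of (periodiseF (n * p k) (toF (arr (n * p k) V'))) * Matrix.of (periodiseF (n * p k) (toF (arr (n * p k) V)))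
          + Matrix.of (periodiseF (n * p k) (toF lapU)) * Matrix.of (periodiseF (n * p k) (toF (arr (n * p k) W))))) atTop
      (𝓝 (2 * ((1 / 2) * tadpole (Ggh n a) (((n : ℝ) ^ 2) • W) - (1 / 2) * bubble (Ggh n a) (((n : ℝ) ^ 2) • V) (((n : ℝ) ^ 2) • V'))
        - ((1 / 2) * (tr (comp (comp (Pgt n a) (Ggh n a)) (((n : ℝ) ^ 2) • W))
            + tr (comp (comp (Ggh n a) (Pgt n a)) (((n : ℝ) ^ 2) • W))
            + tr (comp (comp (comp (Ggh n a) (comp (Pgt n a) (Ggh n a))) (((n : ℝ) ^ 2) • V)) (((n : ℝ) ^ 2) • V'))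
            + tr (comp (comp (comp (Ggh n a) (comp (Pgt n a) (Ggh n a))) (((n : ℝ) ^ 2) • V')) (((n : ℝ) ^ 2) • V)))
          - (1 / 2) * (tr (comp (comp (Ggh n a) (((n : ℝ) ^ 2) • V)) (comp (comp (Pgt n a) (Ggh n a)) (((n : ℝ) ^ 2) • V')))
            + tr (comp (comp (comp (Pgt n a) (Ggh n a)) (((n : ℝ) ^ 2) • V)) (comp (Ggh n a) (((n : ℝ) ^ 2) • V')))
            + tr (comp (comp (comp (Ggh n a) (Ggh n a)) (((n : ℝ) ^ 2) • V)) (comp (Pgt n a) (((n : ℝ) ^ 2) • V')))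
            + tr (comp (comp (comp (Ggh n a) (comp (Pgt n a) (Ggh n a))) (((n : ℝ) ^ 2) • V)) (((n : ℝ) ^ 2) • V'))
            + tr (comp (comp (comp (Ggh n a) (comp (Pgt n a) (Ggh n a))) (((n : ℝ) ^ 2) • V')) (((n : ℝ) ^ 2) • V))
            + tr (comp (comp (Pgt n a) (((n : ℝ) ^ 2) • V)) (comp (comp (Ggh n a) (Ggh n a)) (((n : ℝ) ^ 2) • V')))
            + tr (comp (comp (Ggh n a) (((n : ℝ) ^ 2) • V)) (comp (comp (Ggh n a) (Pgt n a)) (((n : ℝ) ^ 2) • V')))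
            + tr (comp (comp (comp (Ggh n a) (Pgt n a)) (((n : ℝ) ^ 2) • V)) (comp (Ggh n a) (((n : ℝ) ^ 2) • V'))))
          + (1 / 2) * (tr (comp (comp (comp (Pgt n a) (Ggh n a)) (((n : ℝ) ^ 2) • V)) (comp (comp (Pgt n a) (Ggh n a)) (((n : ℝ) ^ 2) • V')))
            + tr (comp (comp (comp (Ggh n a) (comp (Pgt n a) (Ggh n a))) (((n : ℝ) ^ 2) • V)) (comp (Pgt n a) (((n : ℝ) ^ 2) • V')))
            + tr (comp (comp (Pgt n a) (((n : ℝ) ^ 2) • V)) (comp (comp (Ggh n a) (comp (Pgt n a) (Ggh n a))) (((n : ℝ) ^ 2) • V')))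
            + tr (comp (comp (comp (Ggh n a) (Pgt n a)) (((n : ℝ) ^ 2) • V)) (comp (comp (Ggh n a) (Pgt n a)) (((n : ℝ) ^ 2) • V'))))))) := by
  -- THE LEGS: decay, positivity of the rates, joint periodicity along `n·p k`
  have h4 : 0 < 4 * (n : ℝ) := mul_pos four_pos (Nat.cast_pos.2 (Nat.pos_of_ne_zero (NeZero.ne n)))
  have hδG : 0 < deltaU 4 a / (4 * n) := div_pos (deltaU_pos 4 ha) h4
  have hδP : 0 < deltaPP 4 a / (4 * n) := div_pos (deltaPP_pos 4 ha) h4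
  have hG := decays_Ggh n a ha
  have hP := decays_Pgt n a ha
  have hm : 0 < min (deltaU 4 a / (4 * n)) (deltaPP 4 a / (4 * n)) := lt_min hδG hδP
  have hGm := decays_of_le hG (min_le_left _ _ : min (deltaU 4 a / (4 * n)) (deltaPP 4 a / (4 * n)) ≤ _)
  have hPm := decays_of_le hP (min_le_right _ _ : min (deltaU 4 a / (4 * n)) (deltaPP 4 a / (4 * n)) ≤ _)
  have hPG := decays_comp hPm hGm (half_pos hm).le (half_lt_self hm)
  have hGP := decays_comp hGm hPm (half_pos hm).le (half_lt_self hm)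
  have hGG := decays_comp hGm hGm (half_pos hm).le (half_lt_self hm)
  have hm2 : 0 < min (deltaU 4 a / (4 * n)) (deltaPP 4 a / (4 * n)) / 2 := half_pos hm
  have hGPG := decays_comp (decays_of_le hGm (half_le_self hm.le)) hPG (half_pos hm2).le (half_lt_self hm2)
  have sG : ∀ t : Fin 4 → ℤ, shiftK ((n : ℤ) • t) (Ggh n a) = Ggh n a := shiftK_Ggh n a ha
  have sP : ∀ t : Fin 4 → ℤ, shiftK ((n : ℤ) • t) (Pgt n a) = Pgt n a := shiftK_Pgt n ha
  have sPG := shiftK_comp_of_shiftK n sP sG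
  have sGP := shiftK_comp_of_shiftK n sG sP
  have sGG := shiftK_comp_of_shiftK n sG sG
  have sGPG := shiftK_comp_of_shiftK n sG sPG
  have perG := fun k => imageShift_mul_of_shiftK n sG (p k)
  have perP := fun k => imageShift_mul_of_shiftK n sP (p k)
  have perPG := fun k => imageShift_mul_of_shiftK n sPG (p k)
  have perGP := fun k => imageShift_mul_of_shiftK n sGP (p k)
  have perGG := fun k => imageShift_mul_of_shiftK n sGG (p k)
  have perGPG := fun k => imageShift_mul_of_shiftK n sGPG (p k)
  have hσ : Tendsto (fun k => n * p k) atTop atTop := tendsto_mul_period n hp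
  -- THE RESCALED JETS
  have hVc := biLoc_smul' ((n : ℝ) ^ 2) hV
  have hVc' := biLoc_smul' ((n : ℝ) ^ 2) hV'
  have hWc := biLoc_smul' ((n : ℝ) ^ 2) hW
  -- THE MAIN TERM
  have tMT := tendsto_trace_tadpole (σ := fun k => n * p k) hG hδG perG hWc hδ hσ
  have tMB := tendsto_trace_bubble (σ := fun k => n * p k) hG hδG perG hVc hVc' hδ hσ
  have tMain : Tendsto (fun k => 2 * hessT (Matrix.of (periodiseF (n * p k) (toF (Ggh n a)))) (Matrix.of (periodiseF (n * p k) (toF (arr (n * p k) (((n : ℝ) ^ 2) • V)))))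
      (Matrix.of (periodiseF (n * p k) (toF (arr (n * p k) (((n : ℝ) ^ 2) • V'))))) (Matrix.of (periodiseF (n * p k) (toF (arr (n * p k) (((n : ℝ) ^ 2) • W)))))) atTop
      (𝓝 (2 * ((1 / 2) * tadpole (Ggh n a) (((n : ℝ) ^ 2) • W) - (1 / 2) * bubble (Ggh n a) (((n : ℝ) ^ 2) • V) (((n : ℝ) ^ 2) • V')))) := by
    have h := ((tMT.sub tMB).const_mul (1 / 2 : ℝ)).const_mul (2 : ℝ)
    have e : (2 : ℝ) * (1 / 2 * (tadpole (Ggh n a) (((n : ℝ) ^ 2) • W) - bubble (Ggh n a) (((n : ℝ) ^ 2) • V) (((n : ℝ) ^ 2) • V')))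
        = 2 * ((1 / 2) * tadpole (Ggh n a) (((n : ℝ) ^ 2) • W) - (1 / 2) * bubble (Ggh n a) (((n : ℝ) ^ 2) • V) (((n : ℝ) ^ 2) • V')) := by ring
    rw [e] at h
    exact h.congr fun k => by unfold hessT; rfl
  -- THE FOUR TADPOLE-SHAPED WORDS
  have tT1 := tendsto_trace_tadpole (σ := fun k => n * p k) hPG (half_pos hm) perPG hWc hδ hσ
  have tT2 := tendsto_trace_tadpole (σ := fun k => n * p k) hGP (half_pos hm) perGP hWc hδ hσ
  have tT3 := (tendsto_trace_arr_arr (σ := fun k => n * p k) hGPG (half_pos hm2) perGPG hVc hVc' hδ hσ).congr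
    fun k => by rw [Matrix.mul_assoc]
  have tT4 := (tendsto_trace_arr_arr (σ := fun k => n * p k) hGPG (half_pos hm2) perGPG hVc' hVc hδ hσ).congr
    fun k => by rw [Matrix.mul_assoc]
  -- THE EIGHT SINGLE-`P` BUBBLE WORDS
  have tB1 := tendsto_trace_bubble₂' (σ := fun k => n * p k) hG hδG hPG (half_pos hm) perG perPG hVc hVc' hδ hσ
  have tB2 := tendsto_trace_bubble₂' (σ := fun k => n * p k) hPG (half_pos hm) hG hδG perPG perG hVc hVc' hδ hσ
  have tB3 := tendsto_trace_bubble₂' (σ := fun k => n * p k) hGG (half_pos hm) hP hδP perGG perP hVc hVc' hδ hσ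
  have tB4 := tendsto_trace_arr_arr (σ := fun k => n * p k) hGPG (half_pos hm2) perGPG hVc hVc' hδ hσ
  have tB5 := (tendsto_trace_arr_arr (σ := fun k => n * p k) hGPG (half_pos hm2) perGPG hVc' hVc hδ hσ).congr
    fun k => by rw [Matrix.trace_mul_comm]
  have tB6 := tendsto_trace_bubble₂' (σ := fun k => n * p k) hP hδP hGG (half_pos hm) perP perGG hVc hVc' hδ hσ
  have tB7 := tendsto_trace_bubble₂' (σ := fun k => n * p k) hG hδG hGP (half_pos hm) perG perGP hVc hVc' hδ hσ
  have tB8 := tendsto_trace_bubble₂' (σ := fun k => n * p k) hGP (half_pos hm) hG hδG perGP perG hVc hVc' hδ hσ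
  -- THE FOUR DOUBLE-`P` BUBBLE WORDS
  have tD1 := tendsto_trace_bubble₂' (σ := fun k => n * p k) hPG (half_pos hm) hPG (half_pos hm) perPG perPG hVc hVc' hδ hσ
  have tD2 := tendsto_trace_bubble₂' (σ := fun k => n * p k) hGPG (half_pos hm2) hP hδP perGPG perP hVc hVc' hδ hσ
  have tD3 := tendsto_trace_bubble₂' (σ := fun k => n * p k) hP hδP hGPG (half_pos hm2) perP perGPG hVc hVc' hδ hσ
  have tD4 := tendsto_trace_bubble₂' (σ := fun k => n * p k) hGP (half_pos hm) hGP (half_pos hm) perGP perGP hVc hVc' hδ hσ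
  -- ASSEMBLY in the sixteen-slot layout of `eightWords_split` (composite legs as hats, rescaled arrays)
  have hRHS : Tendsto (fun k => 2 * hessT (Matrix.of (periodiseF (n * p k) (toF (Ggh n a)))) (Matrix.of (periodiseF (n * p k) (toF (arr (n * p k) (((n : ℝ) ^ 2) • V)))))
        (Matrix.of (periodiseF (n * p k) (toF (arr (n * p k) (((n : ℝ) ^ 2) • V'))))) (Matrix.of (periodiseF (n * p k) (toF (arr (n * p k) (((n : ℝ) ^ 2) • W)))))
      - ((1 / 2) * ((Matrix.of (periodiseF (n * p k) (toF (comp (Pgt n a) (Ggh n a)))) * Matrix.of (periodiseF (n * p k) (toF (arr (n * p k) (((n : ℝ) ^ 2) • W))))).trace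
              + (Matrix.of (periodiseF (n * p k) (toF (comp (Ggh n a) (Pgt n a)))) * Matrix.of (periodiseF (n * p k) (toF (arr (n * p k) (((n : ℝ) ^ 2) • W))))).trace
              + (Matrix.of (periodiseF (n * p k) (toF (comp (Ggh n a) (comp (Pgt n a) (Ggh n a))))) * (Matrix.of (periodiseF (n * p k) (toF (arr (n * p k) (((n : ℝ) ^ 2) • V)))) * Matrix.of (periodiseF (n * p k) (toF (arr (n * p k) (((n : ℝ) ^ 2) • V')))))).trace
              + (Matrix.of (periodiseF (n * p k) (toF (comp (Ggh n a) (comp (Pgt n a) (Ggh n a))))) * (Matrix.of (periodiseF (n * p k) (toF (arr (n * p k) (((n : ℝ) ^ 2) • V')))) * Matrix.of (periodiseF (n * p k) (toF (arr (n * p k) (((n : ℝ) ^ 2) • V)))))).trace)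
            - (1 / 2) * ((Matrix.of (periodiseF (n * p k) (toF (Ggh n a))) * Matrix.of (periodiseF (n * p k) (toF (arr (n * p k) (((n : ℝ) ^ 2) • V)))) * (Matrix.of (periodiseF (n * p k) (toF (comp (Pgt n a) (Ggh n a)))) * Matrix.of (periodiseF (n * p k) (toF (arr (n * p k) (((n : ℝ) ^ 2) • V')))))).trace
              + (Matrix.of (periodiseF (n * p k) (toF (comp (Pgt n a) (Ggh n a)))) * Matrix.of (periodiseF (n * p k) (toF (arr (n * p k) (((n : ℝ) ^ 2) • V)))) * (Matrix.of (periodiseF (n * p k) (toF (Ggh n a))) * Matrix.of (periodiseF (n * p k) (toF (arr (n * p k) (((n : ℝ) ^ 2) • V')))))).trace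
              + (Matrix.of (periodiseF (n * p k) (toF (comp (Ggh n a) (Ggh n a)))) * Matrix.of (periodiseF (n * p k) (toF (arr (n * p k) (((n : ℝ) ^ 2) • V)))) * (Matrix.of (periodiseF (n * p k) (toF (Pgt n a))) * Matrix.of (periodiseF (n * p k) (toF (arr (n * p k) (((n : ℝ) ^ 2) • V')))))).trace
              + (Matrix.of (periodiseF (n * p k) (toF (comp (Ggh n a) (comp (Pgt n a) (Ggh n a))))) * Matrix.of (periodiseF (n * p k) (toF (arr (n * p k) (((n : ℝ) ^ 2) • V)))) * Matrix.of (periodiseF (n * p k) (toF (arr (n * p k) (((n : ℝ) ^ 2) • V'))))).trace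
              + (Matrix.of (periodiseF (n * p k) (toF (arr (n * p k) (((n : ℝ) ^ 2) • V)))) * (Matrix.of (periodiseF (n * p k) (toF (comp (Ggh n a) (comp (Pgt n a) (Ggh n a))))) * Matrix.of (periodiseF (n * p k) (toF (arr (n * p k) (((n : ℝ) ^ 2) • V')))))).trace
              + (Matrix.of (periodiseF (n * p k) (toF (Pgt n a))) * Matrix.of (periodiseF (n * p k) (toF (arr (n * p k) (((n : ℝ) ^ 2) • V)))) * (Matrix.of (periodiseF (n * p k) (toF (comp (Ggh n a) (Ggh n a)))) * Matrix.of (periodiseF (n * p k) (toF (arr (n * p k) (((n : ℝ) ^ 2) • V')))))).trace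
              + (Matrix.of (periodiseF (n * p k) (toF (Ggh n a))) * Matrix.of (periodiseF (n * p k) (toF (arr (n * p k) (((n : ℝ) ^ 2) • V)))) * (Matrix.of (periodiseF (n * p k) (toF (comp (Ggh n a) (Pgt n a)))) * Matrix.of (periodiseF (n * p k) (toF (arr (n * p k) (((n : ℝ) ^ 2) • V')))))).trace
              + (Matrix.of (periodiseF (n * p k) (toF (comp (Ggh n a) (Pgt n a)))) * Matrix.of (periodiseF (n * p k) (toF (arr (n * p k) (((n : ℝ) ^ 2) • V)))) * (Matrix.of (periodiseF (n * p k) (toF (Ggh n a))) * Matrix.of (periodiseF (n * p k) (toF (arr (n * p k) (((n : ℝ) ^ 2) • V')))))).trace)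
            + (1 / 2) * ((Matrix.of (periodiseF (n * p k) (toF (comp (Pgt n a) (Ggh n a)))) * Matrix.of (periodiseF (n * p k) (toF (arr (n * p k) (((n : ℝ) ^ 2) • V)))) * (Matrix.of (periodiseF (n * p k) (toF (comp (Pgt n a) (Ggh n a)))) * Matrix.of (periodiseF (n * p k) (toF (arr (n * p k) (((n : ℝ) ^ 2) • V')))))).trace
              + (Matrix.of (periodiseF (n * p k) (toF (comp (Ggh n a) (comp (Pgt n a) (Ggh n a))))) * Matrix.of (periodiseF (n * p k) (toF (arr (n * p k) (((n : ℝ) ^ 2) • V)))) * (Matrix.of (periodiseF (n * p k) (toF (Pgt n a))) * Matrix.of (periodiseF (n * p k) (toF (arr (n * p k) (((n : ℝ) ^ 2) • V')))))).trace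
              + (Matrix.of (periodiseF (n * p k) (toF (Pgt n a))) * Matrix.of (periodiseF (n * p k) (toF (arr (n * p k) (((n : ℝ) ^ 2) • V)))) * (Matrix.of (periodiseF (n * p k) (toF (comp (Ggh n a) (comp (Pgt n a) (Ggh n a))))) * Matrix.of (periodiseF (n * p k) (toF (arr (n * p k) (((n : ℝ) ^ 2) • V')))))).trace
              + (Matrix.of (periodiseF (n * p k) (toF (comp (Ggh n a) (Pgt n a)))) * Matrix.of (periodiseF (n * p k) (toF (arr (n * p k) (((n : ℝ) ^ 2) • V)))) * (Matrix.of (periodiseF (n * p k) (toF (comp (Ggh n a) (Pgt n a)))) * Matrix.of (periodiseF (n * p k) (toF (arr (n * p k) (((n : ℝ) ^ 2) • V')))))).trace))) atTop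
      (𝓝 (2 * ((1 / 2) * tadpole (Ggh n a) (((n : ℝ) ^ 2) • W) - (1 / 2) * bubble (Ggh n a) (((n : ℝ) ^ 2) • V) (((n : ℝ) ^ 2) • V'))
        - ((1 / 2) * (tr (comp (comp (Pgt n a) (Ggh n a)) (((n : ℝ) ^ 2) • W))
            + tr (comp (comp (Ggh n a) (Pgt n a)) (((n : ℝ) ^ 2) • W))
            + tr (comp (comp (comp (Ggh n a) (comp (Pgt n a) (Ggh n a))) (((n : ℝ) ^ 2) • V)) (((n : ℝ) ^ 2) • V'))
            + tr (comp (comp (comp (Ggh n a) (comp (Pgt n a) (Ggh n a))) (((n : ℝ) ^ 2) • V')) (((n : ℝ) ^ 2) • V)))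
          - (1 / 2) * (tr (comp (comp (Ggh n a) (((n : ℝ) ^ 2) • V)) (comp (comp (Pgt n a) (Ggh n a)) (((n : ℝ) ^ 2) • V')))
            + tr (comp (comp (comp (Pgt n a) (Ggh n a)) (((n : ℝ) ^ 2) • V)) (comp (Ggh n a) (((n : ℝ) ^ 2) • V')))
            + tr (comp (comp (comp (Ggh n a) (Ggh n a)) (((n : ℝ) ^ 2) • V)) (comp (Pgt n a) (((n : ℝ) ^ 2) • V')))
            + tr (comp (comp (comp (Ggh n a) (comp (Pgt n a) (Ggh n a))) (((n : ℝ) ^ 2) • V)) (((n : ℝ) ^ 2) • V'))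
            + tr (comp (comp (comp (Ggh n a) (comp (Pgt n a) (Ggh n a))) (((n : ℝ) ^ 2) • V')) (((n : ℝ) ^ 2) • V))
            + tr (comp (comp (Pgt n a) (((n : ℝ) ^ 2) • V)) (comp (comp (Ggh n a) (Ggh n a)) (((n : ℝ) ^ 2) • V')))
            + tr (comp (comp (Ggh n a) (((n : ℝ) ^ 2) • V)) (comp (comp (Ggh n a) (Pgt n a)) (((n : ℝ) ^ 2) • V')))
            + tr (comp (comp (comp (Ggh n a) (Pgt n a)) (((n : ℝ) ^ 2) • V)) (comp (Ggh n a) (((n : ℝ) ^ 2) • V'))))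
          + (1 / 2) * (tr (comp (comp (comp (Pgt n a) (Ggh n a)) (((n : ℝ) ^ 2) • V)) (comp (comp (Pgt n a) (Ggh n a)) (((n : ℝ) ^ 2) • V')))
            + tr (comp (comp (comp (Ggh n a) (comp (Pgt n a) (Ggh n a))) (((n : ℝ) ^ 2) • V)) (comp (Pgt n a) (((n : ℝ) ^ 2) • V')))
            + tr (comp (comp (Pgt n a) (((n : ℝ) ^ 2) • V)) (comp (comp (Ggh n a) (comp (Pgt n a) (Ggh n a))) (((n : ℝ) ^ 2) • V')))
            + tr (comp (comp (comp (Ggh n a) (Pgt n a)) (((n : ℝ) ^ 2) • V)) (comp (comp (Ggh n a) (Pgt n a)) (((n : ℝ) ^ 2) • V'))))))) :=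
    tMain.sub ((((((tT1.add tT2).add tT3).add tT4).const_mul (1 / 2 : ℝ)).sub
      ((((((((tB1.add tB2).add tB3).add tB4).add tB5).add tB6).add tB7).add tB8).const_mul (1 / 2 : ℝ))).add
      ((((tD1.add tD2).add tD3).add tD4).const_mul (1 / 2 : ℝ)))
  -- PER TORUS: §2's identity, the rescaled arrays `(arr (n²•V))^ = n²•(arr V)^`, the product letters of the legs
  refine hRHS.congr fun k => ?_
  obtain ⟨ePG, eGP, eGG, eGPG⟩ := hat_legs n a ha (p k)
  rw [hessT_Cgh_biLaplacian_split n a ha ⟨p k, rfl⟩, hat_arr_smul (n * p k) ((n : ℝ) ^ 2) V, hat_arr_smul (n * p k) ((n : ℝ) ^ 2) V',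
    hat_arr_smul (n * p k) ((n : ℝ) ^ 2) W, eGPG, eGP, ePG, eGG]

end Limit

/-! ## §2 The same in FAMILY form: the limit is `2·hessKer (Ggh n a) (n²•𝒱) (n²•𝒲) μ ν z − (sixteen words)` (ρ-g15-1 display) -/

section Family

variable (n : ℕ) [NeZero n] (a : ℝ) {P P' Q Q' : Fin 4 → ℤ} {C Cv Cv' δ : ℝ} {p : ℕ → ℕ} [∀ k, NeZero (p k)]

/-- [folklore] **GH-DICT PART 2b, FAMILY FORM (ρ-g15-1 display).**  For scalar base-point families `𝒱` (first jets `𝒱 μ 0`, `𝒱 ν z`) and `𝒲` (mixed second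
jet `𝒲 μ 0 ν z`), bi-localised at a common rate, the torus bi-Laplacian ghost functional of `(Cgh n a)^` over the periodised arrays converges along
`Site 4 (n·p_k)`, `p_k → ∞`, to **`2·hessKer (Ggh n a) (n²•𝒱) (n²•𝒲) μ ν z`** (`ExpKernelCalculus.hessKer`; loop weight `2`, ONE leg `Ggh`, jets rescaled
by `n²` = the END's ray letter `cK n = cgh n·n²`) MINUS the sixteen `ℤ⁴` words (§1 read at `V := 𝒱 μ 0`, `V′ := 𝒱 ν z`, `W := 𝒲 μ 0 ν z`; `hessKer` by `rfl`). -/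
theorem tendsto_hessT_Cgh_biLaplacian_family (ha : 0 < a) (𝒱 : Fin 4 → (Fin 4 → ℤ) → MKer 4 Unit)
    (𝒲 : Fin 4 → (Fin 4 → ℤ) → Fin 4 → (Fin 4 → ℤ) → MKer 4 Unit) (μ ν : Fin 4) (z : Fin 4 → ℤ)
    (hV : BiLoc (𝒱 μ 0) P P' Cv δ) (hV' : BiLoc (𝒱 ν z) Q' Q Cv' δ) (hW : BiLoc (𝒲 μ 0 ν z) P Q C δ) (hδ : 0 < δ) (hp : Tendsto p atTop atTop) :
    Tendsto (fun k => hessT (Matrix.of (periodiseF (n * p k) (toF (Cgh n a))))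
        (Matrix.of (periodiseF (n * p k) (toF (arr (n * p k) (𝒱 μ 0)))) * Matrix.of (periodiseF (n * p k) (toF lapU))
          + Matrix.of (periodiseF (n * p k) (toF lapU)) * Matrix.of (periodiseF (n * p k) (toF (arr (n * p k) (𝒱 μ 0)))))
        (Matrix.of (periodiseF (n * p k) (toF (arr (n * p k) (𝒱 ν z)))) * Matrix.of (periodiseF (n * p k) (toF lapU))
          + Matrix.of (periodiseF (n * p k) (toF lapU)) * Matrix.of (periodiseF (n * p k) (toF (arr (n * p k) (𝒱 ν z)))))
        (Matrix.of (periodiseF (n * p k) (toF (arr (n * p k) (𝒲 μ 0 ν z)))) * Matrix.of (periodiseF (n * p k) (toF lapU))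
          + Matrix.of (periodiseF (n * p k) (toF (arr (n * p k) (𝒱 μ 0)))) * Matrix.of (periodiseF (n * p k) (toF (arr (n * p k) (𝒱 ν z))))
          + Matrix.of (periodiseF (n * p k) (toF (arr (n * p k) (𝒱 ν z)))) * Matrix.of (periodiseF (n * p k) (toF (arr (n * p k) (𝒱 μ 0))))
          + Matrix.of (periodiseF (n * p k) (toF lapU)) * Matrix.of (periodiseF (n * p k) (toF (arr (n * p k) (𝒲 μ 0 ν z)))))) atTop
      (𝓝 (2 * hessKer (Ggh n a) (fun κ u => ((n : ℝ) ^ 2) • 𝒱 κ u) (fun κ u l u' => ((n : ℝ) ^ 2) • 𝒲 κ u l u') μ ν z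
        - ((1 / 2) * (tr (comp (comp (Pgt n a) (Ggh n a)) (((n : ℝ) ^ 2) • 𝒲 μ 0 ν z))
            + tr (comp (comp (Ggh n a) (Pgt n a)) (((n : ℝ) ^ 2) • 𝒲 μ 0 ν z))
            + tr (comp (comp (comp (Ggh n a) (comp (Pgt n a) (Ggh n a))) (((n : ℝ) ^ 2) • 𝒱 μ 0)) (((n : ℝ) ^ 2) • 𝒱 ν z))
            + tr (comp (comp (comp (Ggh n a) (comp (Pgt n a) (Ggh n a))) (((n : ℝ) ^ 2) • 𝒱 ν z)) (((n : ℝ) ^ 2) • 𝒱 μ 0)))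
          - (1 / 2) * (tr (comp (comp (Ggh n a) (((n : ℝ) ^ 2) • 𝒱 μ 0)) (comp (comp (Pgt n a) (Ggh n a)) (((n : ℝ) ^ 2) • 𝒱 ν z)))
            + tr (comp (comp (comp (Pgt n a) (Ggh n a)) (((n : ℝ) ^ 2) • 𝒱 μ 0)) (comp (Ggh n a) (((n : ℝ) ^ 2) • 𝒱 ν z)))
            + tr (comp (comp (comp (Ggh n a) (Ggh n a)) (((n : ℝ) ^ 2) • 𝒱 μ 0)) (comp (Pgt n a) (((n : ℝ) ^ 2) • 𝒱 ν z)))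
            + tr (comp (comp (comp (Ggh n a) (comp (Pgt n a) (Ggh n a))) (((n : ℝ) ^ 2) • 𝒱 μ 0)) (((n : ℝ) ^ 2) • 𝒱 ν z))
            + tr (comp (comp (comp (Ggh n a) (comp (Pgt n a) (Ggh n a))) (((n : ℝ) ^ 2) • 𝒱 ν z)) (((n : ℝ) ^ 2) • 𝒱 μ 0))
            + tr (comp (comp (Pgt n a) (((n : ℝ) ^ 2) • 𝒱 μ 0)) (comp (comp (Ggh n a) (Ggh n a)) (((n : ℝ) ^ 2) • 𝒱 ν z)))
            + tr (comp (comp (Ggh n a) (((n : ℝ) ^ 2) • 𝒱 μ 0)) (comp (comp (Ggh n a) (Pgt n a)) (((n : ℝ) ^ 2) • 𝒱 ν z)))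
            + tr (comp (comp (comp (Ggh n a) (Pgt n a)) (((n : ℝ) ^ 2) • 𝒱 μ 0)) (comp (Ggh n a) (((n : ℝ) ^ 2) • 𝒱 ν z))))
          + (1 / 2) * (tr (comp (comp (comp (Pgt n a) (Ggh n a)) (((n : ℝ) ^ 2) • 𝒱 μ 0)) (comp (comp (Pgt n a) (Ggh n a)) (((n : ℝ) ^ 2) • 𝒱 ν z)))
            + tr (comp (comp (comp (Ggh n a) (comp (Pgt n a) (Ggh n a))) (((n : ℝ) ^ 2) • 𝒱 μ 0)) (comp (Pgt n a) (((n : ℝ) ^ 2) • 𝒱 ν z)))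
            + tr (comp (comp (Pgt n a) (((n : ℝ) ^ 2) • 𝒱 μ 0)) (comp (comp (Ggh n a) (comp (Pgt n a) (Ggh n a))) (((n : ℝ) ^ 2) • 𝒱 ν z)))
            + tr (comp (comp (comp (Ggh n a) (Pgt n a)) (((n : ℝ) ^ 2) • 𝒱 μ 0)) (comp (comp (Ggh n a) (Pgt n a)) (((n : ℝ) ^ 2) • 𝒱 ν z))))))) :=
  tendsto_hessT_Cgh_biLaplacian n a ha hV hV' hW hδ hp

end Family

/-! ## §3 THE JETS OF RECORD: `hessKer (Cgh n a) Lgh Lgh₂ μ ν z` (the ghost slot of (A1) of record) IN CLOSED FORM -/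

section Record

variable (n : ℕ) [NeZero n] (a : ℝ) {s : ℕ} [NeZero s]

omit [NeZero n] [NeZero s] in
/-- [folklore] The `Unit` re-indexing undone: `((M.submatrix ι ι).submatrix Prod.fst Prod.fst) = M` for `ι x = (x, ())`. -/
theorem submatrix_fst_submatrix_unit (M : Matrix (Site 4 s × Unit) (Site 4 s × Unit) ℝ) :
    (M.submatrix (fun x => (x, ())) (fun y => (y, ()))).submatrix Prod.fst Prod.fst = M := by
  ext ⟨x, u⟩ ⟨y, v⟩
  rfl

omit [NeZero n] in
/-- [folklore] **THE `L̂²`-WORD OF A GHOST CURRENT IS THE BI-LAPLACIAN WORD OF ITS ARRAY**, fibred currency, every `s`: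
`(arr s (Lgh κ u))^ = (arr s (ghCur κ u))^·(lapU)^ + (lapU)^·(arr s (ghCur κ u))^` (`TorusGhostWordArrays.Lsq_word_eq_perT` + `Ljet_eq_perT` + `Lhat_eq_perT`). -/
theorem hat_arr_Lgh (κ : Fin 4) (u : Fin 4 → ℤ) :
    Matrix.of (periodiseF s (toF (arr s (Lgh κ u))))
      = Matrix.of (periodiseF s (toF (arr s (ghCur κ u)))) * Matrix.of (periodiseF s (toF lapU))
        + Matrix.of (periodiseF s (toF lapU)) * Matrix.of (periodiseF s (toF (arr s (ghCur κ u)))) := by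
  have h := Lsq_word_eq_perT s κ u
  rw [Ljet_eq_perT, Lhat_eq_perT, perT, perT, perT, submatrix_unit_mul, submatrix_unit_mul] at h
  ext ⟨x, u'⟩ ⟨y, v'⟩
  have hxy := congrFun (congrFun h x) y
  simp only [Matrix.add_apply, Matrix.submatrix_apply] at hxy
  rw [Matrix.add_apply]
  exact hxy.symm

omit [NeZero n] in
/-- [folklore] **THE `L̂²` PAIR WORD OF TWO GHOST CURRENTS IS THE BI-LAPLACIAN PAIR WORD OF THEIR ARRAYS**, fibred currency, for `|u − u′|₁ + 3 ≤ s`: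
`(arr s (Lgh₂ κ u l u′))^ = Ŵ·L̂ + V̂·V̂′ + V̂′·V̂ + L̂·Ŵ` with `V̂ = (arr (ghCur κ u))^`, `V̂′ = (arr (ghCur l u′))^`, `Ŵ = (arr ([u = u′ ∧ κ = l]•gh₂ κ u))^`
(`TorusGhostPairArrays.Lsq_pair_word_eq_perT` + `Ljet₁₁_eq_perT`). -/
theorem hat_arr_Lgh₂ (κ : Fin 4) (u : Fin 4 → ℤ) (l : Fin 4) (u' : Fin 4 → ℤ) (hs : l1 (u - u') + 3 ≤ s) :
    Matrix.of (periodiseF s (toF (arr s (Lgh₂ κ u l u'))))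
      = Matrix.of (periodiseF s (toF (arr s (if u = u' ∧ κ = l then gh₂ κ u else 0)))) * Matrix.of (periodiseF s (toF lapU))
        + Matrix.of (periodiseF s (toF (arr s (ghCur κ u)))) * Matrix.of (periodiseF s (toF (arr s (ghCur l u'))))
        + Matrix.of (periodiseF s (toF (arr s (ghCur l u')))) * Matrix.of (periodiseF s (toF (arr s (ghCur κ u))))
        + Matrix.of (periodiseF s (toF lapU)) * Matrix.of (periodiseF s (toF (arr s (if u = u' ∧ κ = l then gh₂ κ u else 0)))) := by
  have hlt : l1 (u - u') < s := by linarith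
  have hW : Ljet₁₁ s (siteOf 4 s u, κ) (siteOf 4 s u', l) = perT s (arr s (if u = u' ∧ κ = l then gh₂ κ u else 0)) := by
    rw [Ljet₁₁_eq_perT s κ u l u' hlt]
    by_cases h : u = u' ∧ κ = l
    · rw [if_pos h, if_pos h]
    · rw [if_neg h, if_neg h, arr_zero, perT_zero]
  have h := Lsq_pair_word_eq_perT s κ u l u' hs
  rw [hW, Ljet_eq_perT, Ljet_eq_perT, Lhat_eq_perT, perT, perT, perT, perT, submatrix_unit_mul, submatrix_unit_mul, submatrix_unit_mul,
    submatrix_unit_mul] at h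
  ext ⟨x, u''⟩ ⟨y, v''⟩
  have hxy := congrFun (congrFun h x) y
  simp only [Matrix.add_apply, Matrix.submatrix_apply] at hxy
  rw [Matrix.add_apply, Matrix.add_apply, Matrix.add_apply]
  exact hxy.symm

omit [NeZero s] in
/-- [folklore] Along `p k → ∞`, eventually `|0 − z|₁ + 3 ≤ n·p k`. -/
theorem eventually_l1_add_three_le (z : Fin 4 → ℤ) {p : ℕ → ℕ} (hp : Tendsto p atTop atTop) :
    ∀ᶠ k in atTop, l1 (0 - z) + 3 ≤ ((n * p k : ℕ) : ℝ) := by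
  obtain ⟨N, hN⟩ := exists_nat_ge (l1 (0 - z) + 3)
  filter_upwards [hp.eventually_ge_atTop N] with k hk
  have h1 : (N : ℝ) ≤ (p k : ℝ) := by exact_mod_cast hk
  have h2 : (p k : ℝ) ≤ ((n * p k : ℕ) : ℝ) := by exact_mod_cast Nat.le_mul_of_pos_left (p k) (Nat.pos_of_ne_zero (NeZero.ne n))
  linarith

omit [NeZero s] in
/-- [folklore] The mixed ghost table of record `[0 = z ∧ μ = ν]•gh₂ μ 0` is bi-localised at `(0, z)` at every rate. -/
theorem biLoc_gh₁₁ (μ ν : Fin 4) (z : Fin 4 → ℤ) (δ' : ℝ) :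
    BiLoc (if (0 : Fin 4 → ℤ) = z ∧ μ = ν then gh₂ μ 0 else 0) 0 z (Real.exp δ' + Real.exp δ') δ' := by
  by_cases h : (0 : Fin 4 → ℤ) = z ∧ μ = ν
  · rw [if_pos h, ← h.1]; exact biLoc_gh₂ μ 0 δ'
  · rw [if_neg h]; exact biLoc_zero_of_nonneg 0 z (by positivity) δ'

/-- [folklore] **GH-DICT PART 2b AT THE JETS OF RECORD — THE GHOST SLOT OF (A1) OF RECORD IN CLOSED FORM.**  For `0 < a`, `n ≥ 1`, every channel
`μ ν` and coarse separation `z`: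
`hessKer (Cgh n a) Lgh Lgh₂ μ ν z = 2·hessKer (Ggh n a) (n²•ghCur) (n²•gh₁₁) μ ν z − (sixteen ℤ⁴ words at V := n²•ghCur μ 0, V′ := n²•ghCur ν z, W := n²•gh₁₁ μ 0 ν z)`,
`gh₁₁ κ u l u′ := [u = u′ ∧ κ = l]•gh₂ κ u` — i.e. the left member of `KCombineCovStripped.hessKer_transfer_road_cov_stripped`'s ghost slot
(`KCombineCovTowers.tendsto_gramCov_tower`) IS loop weight `2` × ONE leg `Ggh` × the `n²`-rescaled FINE-bond ghost currents, minus the named `P`-remainder.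
PROOF: both members are limits of the same torus sequence — `KGhostLeg.tendsto_hessT_Cgh` (arrays of `Lgh`∕`Lgh₂`) and §2 (bi-Laplacian words of the arrays of
`ghCur`∕`gh₁₁`), equal torus by torus for `|z|₁ + 3 ≤ n·p_k` (`hat_arr_Lgh`, `hat_arr_Lgh₂`), along the tori `p_k := k + 1` — and limits in `ℝ` are unique.
Nothing about `PghQ` (PART 3). -/
theorem hessKer_Cgh_Lgh_eq (ha : 0 < a) (μ ν : Fin 4) (z : Fin 4 → ℤ) :
    hessKer (Cgh n a) (fun κ v => Lgh κ v) (fun κ v l v' => Lgh₂ κ v l v') μ ν z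
      = 2 * hessKer (Ggh n a) (fun κ u => ((n : ℝ) ^ 2) • ghCur κ u)
          (fun κ u l u' => ((n : ℝ) ^ 2) • (if u = u' ∧ κ = l then gh₂ κ u else 0)) μ ν z
        - ((1 / 2) * (tr (comp (comp (Pgt n a) (Ggh n a)) (((n : ℝ) ^ 2) • (if (0 : Fin 4 → ℤ) = z ∧ μ = ν then gh₂ μ 0 else 0)))
            + tr (comp (comp (Ggh n a) (Pgt n a)) (((n : ℝ) ^ 2) • (if (0 : Fin 4 → ℤ) = z ∧ μ = ν then gh₂ μ 0 else 0)))
            + tr (comp (comp (comp (Ggh n a) (comp (Pgt n a) (Ggh n a))) (((n : ℝ) ^ 2) • ghCur μ 0)) (((n : ℝ) ^ 2) • ghCur ν z))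
            + tr (comp (comp (comp (Ggh n a) (comp (Pgt n a) (Ggh n a))) (((n : ℝ) ^ 2) • ghCur ν z)) (((n : ℝ) ^ 2) • ghCur μ 0)))
          - (1 / 2) * (tr (comp (comp (Ggh n a) (((n : ℝ) ^ 2) • ghCur μ 0)) (comp (comp (Pgt n a) (Ggh n a)) (((n : ℝ) ^ 2) • ghCur ν z)))
            + tr (comp (comp (comp (Pgt n a) (Ggh n a)) (((n : ℝ) ^ 2) • ghCur μ 0)) (comp (Ggh n a) (((n : ℝ) ^ 2) • ghCur ν z)))
            + tr (comp (comp (comp (Ggh n a) (Ggh n a)) (((n : ℝ) ^ 2) • ghCur μ 0)) (comp (Pgt n a) (((n : ℝ) ^ 2) • ghCur ν z)))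
            + tr (comp (comp (comp (Ggh n a) (comp (Pgt n a) (Ggh n a))) (((n : ℝ) ^ 2) • ghCur μ 0)) (((n : ℝ) ^ 2) • ghCur ν z))
            + tr (comp (comp (comp (Ggh n a) (comp (Pgt n a) (Ggh n a))) (((n : ℝ) ^ 2) • ghCur ν z)) (((n : ℝ) ^ 2) • ghCur μ 0))
            + tr (comp (comp (Pgt n a) (((n : ℝ) ^ 2) • ghCur μ 0)) (comp (comp (Ggh n a) (Ggh n a)) (((n : ℝ) ^ 2) • ghCur ν z)))
            + tr (comp (comp (Ggh n a) (((n : ℝ) ^ 2) • ghCur μ 0)) (comp (comp (Ggh n a) (Pgt n a)) (((n : ℝ) ^ 2) • ghCur ν z)))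
            + tr (comp (comp (comp (Ggh n a) (Pgt n a)) (((n : ℝ) ^ 2) • ghCur μ 0)) (comp (Ggh n a) (((n : ℝ) ^ 2) • ghCur ν z))))
          + (1 / 2) * (tr (comp (comp (comp (Pgt n a) (Ggh n a)) (((n : ℝ) ^ 2) • ghCur μ 0)) (comp (comp (Pgt n a) (Ggh n a)) (((n : ℝ) ^ 2) • ghCur ν z)))
            + tr (comp (comp (comp (Ggh n a) (comp (Pgt n a) (Ggh n a))) (((n : ℝ) ^ 2) • ghCur μ 0)) (comp (Pgt n a) (((n : ℝ) ^ 2) • ghCur ν z)))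
            + tr (comp (comp (Pgt n a) (((n : ℝ) ^ 2) • ghCur μ 0)) (comp (comp (Ggh n a) (comp (Pgt n a) (Ggh n a))) (((n : ℝ) ^ 2) • ghCur ν z)))
            + tr (comp (comp (comp (Ggh n a) (Pgt n a)) (((n : ℝ) ^ 2) • ghCur μ 0)) (comp (comp (Ggh n a) (Pgt n a)) (((n : ℝ) ^ 2) • ghCur ν z))))) := by
  have hp : Tendsto (fun k : ℕ => k + 1) atTop atTop := tendsto_add_atTop_nat 1
  have h1 := tendsto_hessT_Cgh n a ha (p := fun k => k + 1) (fun κ v => Lgh κ v) (fun κ v l v' => Lgh₂ κ v l v') μ ν z (biLoc_Lgh μ 0)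
    (biLoc_Lgh ν z) (biLoc_Lgh₂ μ 0 ν z) (by norm_num) hp
  have h2 := tendsto_hessT_Cgh_biLaplacian_family n a ha (p := fun k => k + 1) (fun κ u => ghCur κ u)
    (fun κ u l u' => if u = u' ∧ κ = l then gh₂ κ u else 0) μ ν z (biLoc_ghCur μ 0 1) (biLoc_ghCur ν z 1) (biLoc_gh₁₁ μ ν z 1) one_pos hp
  refine tendsto_nhds_unique (h1.congr' ?_) h2
  filter_upwards [eventually_l1_add_three_le n z hp] with k hk
  rw [hat_arr_Lgh, hat_arr_Lgh, hat_arr_Lgh₂ μ 0 ν z hk]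

end Record

end Summit.QuantumFields.BalabanUV.Beta.D1BFx.GhostSqrtLegLimit

end
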